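import Summits.BirchSwinnertonDyer.BirchSwinnertonDyer.Theorems.EisensteinPrimesBSDpOnCellCRetractionSpecializationTorsion
import Summits.BirchSwinnertonDyer.BirchSwinnertonDyer.Theorems.SignedLowerHalvesSmallImageLowerHalfBothSignsRttCharRoadE2SpecialisationModel
import Summits.BirchSwinnertonDyer.Rank1Residual.X1.LambdaSqueezeAlgebra
import Literature.NumberTheory.IwasawaTheory.IwasawaAlgebraTwoVarRegularProofs
import HarnessLib

/-!
# Route `SignedLowerHalves`, crux L `SmallImageLowerHalfBothSigns` (item stmt-BirchSwinnertonDyer-23599), line `rtt_w3` v13 — E2,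
# row **D2-λspec** (HELPER-TABLE v13 addendum 1; BRIEF-E2 rev 2.1 §6): the λ-SPECIALISATION LEMMA along the twist
# specialisation `φ_u : Λ₂ = ℤ_p⟦T₂⟧⟦T₁⟧ ↠ Λ = ℤ_p⟦T₁⟧`, `f = (1+T₂) − u`:
# `λ_Λ(N/fN) = λ_Λ(N[f]) + lam(φ_u g)` for a finitely generated torsion `Λ₂`-module `N` with `char_{Λ₂} N = (g)`, `φ_u g ≠ 0`

Width seat `bsd-line-slh-p3-w3` g19 under LEAD `cruxlead-stmt-BirchSwinnertonDyer-23599` (g8 offer 13:10:51Z «NEXT FREE ROW … λ-SPECIALISATION along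
f = (1+T₂) − u»; cell `bsd-ssimc`); ROUTE-INDEPENDENT helper (`--supports stmt-BirchSwinnertonDyer-23599`); THEOREMS ONLY — no definition, no
named fact, no instance, no `sorry`; pure commutative algebra; nothing about any Selmer group, zeta element or elliptic unit is asserted; closes nothing;
BSD is not proved by any of this.

WHY. Under the LEAD's architecture ruling (§6) E2-K is the SPECIALISATION of the tree's two-variable elliptic-unit data (JLK `cor53_thm52Shape`:
`char_{Λ₂} A = char_{Λ₂} B`) to the `θ`-line along `φ_u` (`…RttCharRoadE2TwistSpecialisation.exists_twistSpecialisation`, p774681: onto, `φ_u f = 0`,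
`φ_u (C (C a)) = C a`, `φ_u T₁ = T₁`, `ker φ_u = (f)`). Its junction «E2K_alg» in λ-currency is this file's theorem. NO dévissage is re-done here: the
tree ALREADY holds the Herbrand/specialisation formula for characteristic ideals along ANY ring retraction with principal kernel
(`RetractionSpecialization.charIdeal_quotSMulTop_eq_mul_of_retraction`, crux-4 cell C: `char_A(N/πN) = char_A(N[π]) · φ(char_B N)` for factorial
Noetherian domains `A`, `B`), the factoriality of `Λ₂` (`IwasawaTheory.uniqueFactorizationMonoid_iwasawaAlgebraTwoVar`) and of `Λ`, the reading
`λ(M) = lam g` of `char_Λ M = (g)` (`X1.ParitySqueeze.lam_generator_eq_lambdaInvariant`) and `lam`'s additivity (`X1.MuLambda.lam_mul`). What this file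
adds: (i) `φ_u` IS a retraction of the OUTER embedding `ι = PowerSeries.map C : Λ → Λ₂` (`T ↦ T₁`, constants to constants) — derived from the two
exported clauses `φ_u (C (C a)) = C a`, `φ_u X = X` ALONE by the rigidity `ringHom_eq_id_of_map_C_of_map_X` (a ring endomorphism of `A⟦X⟧` fixing `A` and
`X` is the identity: `g ≡ trunc_n g (mod Xⁿ)`); (ii) the instantiation, with the `Λ`-MODULE STRUCTURES STATED EXPLICITLY as restriction of scalars
along `ι` (`Module.compHom N ι`; the LEAD's convention «T acts as T₁», never the ambient `Algebra Λ Λ₂` instances, of which two non-defeq ones exist);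
(iii) the λ-reading.

* §1 `ringHom_eq_id_of_map_C_of_map_X`; `map_outer_eq_self_of_clauses` (`φ (PowerSeries.map C a) = a` for every `a ∈ Λ`).
* §2 ★★ **`lambdaInvariant_quotSMulTop_eq_add_of_twist`** — for `φ : Λ₂ →+* Λ` with the clauses of `exists_twistSpecialisation` (`φ f = 0`, constants,
  `φ X = X`, `ker φ = (f)`), `N` finitely generated over `Λ₂` and killed by some `t ≠ 0`, `char_{Λ₂} N = (g)` with `φ g ≠ 0`: with the `Λ`-structures
  `Module.compHom _ ι` on `N`, hence on `N/fN = QuotSMulTop f N` and on `N[f] = Submodule.torsionBy Λ₂ N f`: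
  `lambdaInvariant p (N/fN) = lambdaInvariant p (N[f]) + lam (φ g)`, and both `N/fN`, `N[f]` are finitely generated TORSION `Λ`-modules (so the
  `lambdaInvariant`s are honest). Also `charIdeal_quotSMulTop_eq_mul_of_twist` (the characteristic-ideal form `char_Λ(N/fN) = char_Λ(N[f])·(φ g)` =
  «detdescent»'s `SpecialisationShape` along `f`), `dvd_of_map_eq_zero`.
* §2 (end) ★ **`lambdaInvariant_quotSMulTop_add_eq_of_charIdeal_eq`** — ROAD D's use: if `char_{Λ₂} A = char_{Λ₂} B` (JLK) then
  `λ(A/fA) + λ(B[f]) = λ(B/fB) + λ(A[f])` (the `lam(φ g)` cancel) — E2-K's λ-inequality is then bookkeeping on the descent sequences.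

References: [BourbakiAC5to7] VII §4.5; [SkinnerUrban2014] §3.1.6, Cor. 3.2.9; [Ochiai2006] Lemma 7.2; [JohnsonLeungKings2011] §4.2, Lemma 4.4, Cor. 5.3;
[Washington1997] §7.1, §13.2.
-/

set_option autoImplicit false
-- the Theorems namespace of this sub repeats the summit name by design (D-0017 nested layout)
set_option linter.dupNamespace false

noncomputable section

open PowerSeries Literature.NumberTheory.EllipticCurves Literature.NumberTheory.EllipticCurves.Module
open Summit.BirchSwinnertonDyer.BirchSwinnertonDyer.Theorems.RetractionSpecialization
open Summit.BirchSwinnertonDyer.BirchSwinnertonDyer.Theorems.SignedBaseChangeAcDivSpecialization.LocalLength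
  (isPrincipal_charIdeal_of_ufm)
open Summit.BirchSwinnertonDyer.Rank1Residual.X1.MuLambda (lam lam_mul)
open Summit.BirchSwinnertonDyer.Rank1Residual.X1.ParitySqueeze (lam_generator_eq_lambdaInvariant)

namespace Summit.BirchSwinnertonDyer.BirchSwinnertonDyer.Theorems.SmallImageRttD2LamSpec

universe v

/-! ## §1. Rigidity: a ring endomorphism of `A⟦X⟧` fixing `A` and `X` is the identity; `φ_u` is a retraction of `ι` -/

/-- **A ring endomorphism of `A⟦X⟧` that fixes the constants and `X` is the identity** (no continuity assumed: for every `n`,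
`g = trunc_n g + Xⁿ·h`, and `ψ` fixes polynomials, so `ψ g ≡ g (mod Xⁿ)`). [folklore] -/
theorem ringHom_eq_id_of_map_C_of_map_X {A : Type*} [CommRing A] (ψ : PowerSeries A →+* PowerSeries A)
    (hC : ∀ a : A, ψ (C a) = C a) (hX : ψ X = X) : ψ = RingHom.id (PowerSeries A) := by
  have hpoly : ∀ q : Polynomial A, ψ (q : PowerSeries A) = q := by
    intro q
    induction q using Polynomial.induction_on' with
    | add q r hq hr => rw [Polynomial.coe_add, map_add, hq, hr]
    | monomial n a =>
      rw [← Polynomial.C_mul_X_pow_eq_monomial, Polynomial.coe_mul, Polynomial.coe_pow, Polynomial.coe_C,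
        Polynomial.coe_X, map_mul, map_pow, hC, hX]
  refine RingHom.ext fun g ↦ ?_
  ext k
  obtain ⟨h, hh⟩ : (X : PowerSeries A) ^ (k + 1) ∣ g - (trunc (k + 1) g : PowerSeries A) := by
    rw [PowerSeries.X_pow_dvd_iff]
    intro m hm
    rw [map_sub, Polynomial.coeff_coe, coeff_trunc, if_pos hm, sub_self]
  have hg : g = (trunc (k + 1) g : PowerSeries A) + X ^ (k + 1) * h := by rw [← hh]; ring
  rw [RingHom.id_apply, hg, map_add, hpoly, map_mul, map_pow, hX, map_add, map_add, coeff_X_pow_mul', coeff_X_pow_mul',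
    if_neg (by omega), if_neg (by omega)]

variable {p : ℕ} [Fact p.Prime]

/-- **`φ_u` is a retraction of the outer embedding `ι = PowerSeries.map C : Λ → Λ₂`** (`T ↦ T₁`, `c ↦ C (C c)`): this follows from the two clauses
`φ (C (C a)) = C a` and `φ X = X` of `exists_twistSpecialisation` alone, by the rigidity of §1 applied to `φ ∘ ι`. [folklore] -/
theorem map_outer_eq_self_of_clauses (φ : IwasawaAlgebra₂ p →+* IwasawaAlgebra p) (hC : ∀ a : ℤ_[p], φ (C (C a)) = C a)
    (hX : φ X = X) (a : IwasawaAlgebra p) :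
    φ (PowerSeries.map (PowerSeries.C : ℤ_[p] →+* IwasawaAlgebra p) a) = a := by
  have h := ringHom_eq_id_of_map_C_of_map_X (φ.comp (PowerSeries.map (PowerSeries.C : ℤ_[p] →+* IwasawaAlgebra p)))
    (fun c ↦ by rw [RingHom.comp_apply, map_C, hC]) (by rw [RingHom.comp_apply, map_X, hX])
  exact DFunLike.congr_fun h a

/-! ## §2. The λ-specialisation lemma along `f = (1+T₂) − u` -/

section Twist

variable (u : ℤ_[p]) (φ : IwasawaAlgebra₂ p →+* IwasawaAlgebra p)
  (hφf : φ (1 + (C (X : IwasawaAlgebra p) : IwasawaAlgebra₂ p) - C (C u)) = 0)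
  (hC : ∀ a : ℤ_[p], φ (C (C a)) = C a) (hX : φ X = X)
  (hker : RingHom.ker φ = Ideal.span {1 + (C (X : IwasawaAlgebra p) : IwasawaAlgebra₂ p) - C (C u)})

include hker in
/-- `ker φ = (f)` in divisibility form. [folklore] -/
theorem dvd_of_map_eq_zero (b : IwasawaAlgebra₂ p) (hb : φ b = 0) :
    (1 + (C (X : IwasawaAlgebra p) : IwasawaAlgebra₂ p) - C (C u)) ∣ b := by
  rw [← Ideal.mem_span_singleton, ← hker]
  exact hb

include hφf hC hX hker in
/-- **Specialisation of characteristic ideals along `φ_u` («detdescent»'s `SpecialisationShape`).** For `N` finitely generated over `Λ₂`, killed by some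
`t ≠ 0`, with `char_{Λ₂} N = (g)` and `φ g ≠ 0`, and the `Λ`-structure on `N` the restriction along `ι = PowerSeries.map C` (stated explicitly):
`char_Λ(N/fN) = char_Λ(N[f]) · (φ g)`. (Instance of `RetractionSpecialization.charIdeal_quotSMulTop_eq_mul_of_retraction`.) [cite: BourbakiAC5to7, VII §4.5]
[cite: SkinnerUrban2014, §3.1.6, Cor. 3.2.9] -/
theorem charIdeal_quotSMulTop_eq_mul_of_twist (N : Type v) [AddCommGroup N] [Module (IwasawaAlgebra₂ p) N]
    [Module.Finite (IwasawaAlgebra₂ p) N] {t : IwasawaAlgebra₂ p} (ht0 : t ≠ 0) (ht : ∀ n : N, t • n = 0)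
    {g : IwasawaAlgebra₂ p} (hg : charIdeal (IwasawaAlgebra₂ p) N = Ideal.span {g}) (hg0 : φ g ≠ 0) :
    letI : Algebra (IwasawaAlgebra p) (IwasawaAlgebra₂ p) :=
      (PowerSeries.map (PowerSeries.C : ℤ_[p] →+* IwasawaAlgebra p)).toAlgebra
    letI : Module (IwasawaAlgebra p) N := Module.compHom N (PowerSeries.map (PowerSeries.C : ℤ_[p] →+* IwasawaAlgebra p))
    haveI : IsScalarTower (IwasawaAlgebra p) (IwasawaAlgebra₂ p) N := IsScalarTower.of_algebraMap_smul fun _ _ ↦ rfl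
    charIdeal (IwasawaAlgebra p) (QuotSMulTop (1 + (C (X : IwasawaAlgebra p) : IwasawaAlgebra₂ p) - C (C u)) N) =
      charIdeal (IwasawaAlgebra p)
          (Submodule.torsionBy (IwasawaAlgebra₂ p) N (1 + (C (X : IwasawaAlgebra p) : IwasawaAlgebra₂ p) - C (C u))) *
        Ideal.span {φ g} := by
  letI : Algebra (IwasawaAlgebra p) (IwasawaAlgebra₂ p) :=
    (PowerSeries.map (PowerSeries.C : ℤ_[p] →+* IwasawaAlgebra p)).toAlgebra
  letI : Module (IwasawaAlgebra p) N := Module.compHom N (PowerSeries.map (PowerSeries.C : ℤ_[p] →+* IwasawaAlgebra p))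
  haveI : IsScalarTower (IwasawaAlgebra p) (IwasawaAlgebra₂ p) N := IsScalarTower.of_algebraMap_smul fun _ _ ↦ rfl
  haveI : UniqueFactorizationMonoid (IwasawaAlgebra₂ p) :=
    Literature.NumberTheory.IwasawaTheory.uniqueFactorizationMonoid_iwasawaAlgebraTwoVar p
  set f : IwasawaAlgebra₂ p := 1 + (C (X : IwasawaAlgebra p) : IwasawaAlgebra₂ p) - C (C u) with hfdef
  have hret : ∀ a : IwasawaAlgebra p, φ (algebraMap (IwasawaAlgebra p) (IwasawaAlgebra₂ p) a) = a :=
    map_outer_eq_self_of_clauses φ hC hX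
  have hker' : ∀ b : IwasawaAlgebra₂ p, φ b = 0 → f ∣ b := dvd_of_map_eq_zero u φ hker
  have hf0 : f ≠ 0 := SmallImageCharSignedSelmer.one_add_CX_sub_CC_ne_zero u
  -- `f ∤ g`, hence some `s` with `φ s ≠ 0` kills `N`
  have hfg : ¬ f ∣ g := fun h ↦ by
    obtain ⟨c, rfl⟩ := h
    exact hg0 (by rw [map_mul, hφf, zero_mul])
  obtain ⟨s, hfs, hs⟩ := exists_not_dvd_smul_eq_zero_of_not_dvd (N := N) hφf hker' hf0 ht0 ht hg hfg
  have hs0 : φ s ≠ 0 := fun h ↦ hfs (hker' s h)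
  have H := charIdeal_quotSMulTop_eq_mul_of_retraction hret hφf hker' hf0 N ⟨s, hs0, hs⟩
  rw [hg, Ideal.map_span, Set.image_singleton] at H
  exact H

include hφf hC hX hker in
/-- ★★ **The λ-specialisation lemma along `f = (1+T₂) − u` (row D2-λspec).** For `φ = φ_u : Λ₂ ↠ Λ` with the clauses of `exists_twistSpecialisation`, `N` a
finitely generated `Λ₂`-module killed by some `t ≠ 0`, `char_{Λ₂} N = (g)` with `φ g ≠ 0`, and the `Λ`-structures on `N/fN`, `N[f]` the restriction along
`ι = PowerSeries.map C : Λ → Λ₂` («`T` acts as `T₁`», stated explicitly): `N/fN` and `N[f]` are finitely generated torsion `Λ`-modules and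
`lambdaInvariant p (N/fN) = lambdaInvariant p (N[f]) + lam (φ g)`, `lam` the Weierstrass λ (`X1.MuLambda.lam`) of the specialised characteristic series —
`λ` is read off the characteristic ideals (`lam_generator_eq_lambdaInvariant`, `lam_mul`) in `char_Λ(N/fN) = char_Λ(N[f])·(φ g)`.
[cite: BourbakiAC5to7, VII §4.5] [cite: SkinnerUrban2014, §3.1.6, Cor. 3.2.9] [cite: Washington1997, §13.2] -/
theorem lambdaInvariant_quotSMulTop_eq_add_of_twist (N : Type v) [AddCommGroup N] [Module (IwasawaAlgebra₂ p) N]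
    [Module.Finite (IwasawaAlgebra₂ p) N] {t : IwasawaAlgebra₂ p} (ht0 : t ≠ 0) (ht : ∀ n : N, t • n = 0)
    {g : IwasawaAlgebra₂ p} (hg : charIdeal (IwasawaAlgebra₂ p) N = Ideal.span {g}) (hg0 : φ g ≠ 0) :
    letI : Algebra (IwasawaAlgebra p) (IwasawaAlgebra₂ p) :=
      (PowerSeries.map (PowerSeries.C : ℤ_[p] →+* IwasawaAlgebra p)).toAlgebra
    letI : Module (IwasawaAlgebra p) N := Module.compHom N (PowerSeries.map (PowerSeries.C : ℤ_[p] →+* IwasawaAlgebra p))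
    haveI : IsScalarTower (IwasawaAlgebra p) (IwasawaAlgebra₂ p) N := IsScalarTower.of_algebraMap_smul fun _ _ ↦ rfl
    Module.Finite (IwasawaAlgebra p) (QuotSMulTop (1 + (C (X : IwasawaAlgebra p) : IwasawaAlgebra₂ p) - C (C u)) N) ∧
      Module.IsTorsion (IwasawaAlgebra p) (QuotSMulTop (1 + (C (X : IwasawaAlgebra p) : IwasawaAlgebra₂ p) - C (C u)) N) ∧
      Module.Finite (IwasawaAlgebra p)
        (Submodule.torsionBy (IwasawaAlgebra₂ p) N (1 + (C (X : IwasawaAlgebra p) : IwasawaAlgebra₂ p) - C (C u))) ∧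
      Module.IsTorsion (IwasawaAlgebra p)
        (Submodule.torsionBy (IwasawaAlgebra₂ p) N (1 + (C (X : IwasawaAlgebra p) : IwasawaAlgebra₂ p) - C (C u))) ∧
      lambdaInvariant p (QuotSMulTop (1 + (C (X : IwasawaAlgebra p) : IwasawaAlgebra₂ p) - C (C u)) N) =
        lambdaInvariant p
            (Submodule.torsionBy (IwasawaAlgebra₂ p) N (1 + (C (X : IwasawaAlgebra p) : IwasawaAlgebra₂ p) - C (C u))) +
          lam (φ g) := by
  letI : Algebra (IwasawaAlgebra p) (IwasawaAlgebra₂ p) :=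
    (PowerSeries.map (PowerSeries.C : ℤ_[p] →+* IwasawaAlgebra p)).toAlgebra
  letI : Module (IwasawaAlgebra p) N := Module.compHom N (PowerSeries.map (PowerSeries.C : ℤ_[p] →+* IwasawaAlgebra p))
  haveI : IsScalarTower (IwasawaAlgebra p) (IwasawaAlgebra₂ p) N := IsScalarTower.of_algebraMap_smul fun _ _ ↦ rfl
  haveI : UniqueFactorizationMonoid (IwasawaAlgebra₂ p) :=
    Literature.NumberTheory.IwasawaTheory.uniqueFactorizationMonoid_iwasawaAlgebraTwoVar p
  set f : IwasawaAlgebra₂ p := 1 + (C (X : IwasawaAlgebra p) : IwasawaAlgebra₂ p) - C (C u) with hfdef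
  have hret : ∀ a : IwasawaAlgebra p, φ (algebraMap (IwasawaAlgebra p) (IwasawaAlgebra₂ p) a) = a :=
    map_outer_eq_self_of_clauses φ hC hX
  have hker' : ∀ b : IwasawaAlgebra₂ p, φ b = 0 → f ∣ b := dvd_of_map_eq_zero u φ hker
  have hf0 : f ≠ 0 := SmallImageCharSignedSelmer.one_add_CX_sub_CC_ne_zero u
  have hfg : ¬ f ∣ g := fun h ↦ by
    obtain ⟨c, rfl⟩ := h
    exact hg0 (by rw [map_mul, hφf, zero_mul])
  obtain ⟨s, hfs, hs⟩ := exists_not_dvd_smul_eq_zero_of_not_dvd (N := N) hφf hker' hf0 ht0 ht hg hfg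
  have hs0 : φ s ≠ 0 := fun h ↦ hfs (hker' s h)
  -- finiteness and torsion of the fibre and the kernel
  haveI hfinQ : Module.Finite (IwasawaAlgebra p) (QuotSMulTop f N) := moduleFinite_quotSMulTop_of_retraction hret hker'
  haveI hfinK : Module.Finite (IwasawaAlgebra p) (Submodule.torsionBy (IwasawaAlgebra₂ p) N f) :=
    moduleFinite_torsionBy_of_retraction hret hker'
  obtain ⟨hQs, hKs⟩ := isTorsionBy_map_of_retraction' (N := N) (π := f) hret hker' hs
  have hs0' : φ s ∈ nonZeroDivisors (IwasawaAlgebra p) := mem_nonZeroDivisors_of_ne_zero hs0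
  have htorQ : Module.IsTorsion (IwasawaAlgebra p) (QuotSMulTop f N) := by
    intro x; exact ⟨⟨φ s, hs0'⟩, @hQs x⟩
  have htorK : Module.IsTorsion (IwasawaAlgebra p) (Submodule.torsionBy (IwasawaAlgebra₂ p) N f) := by
    intro x; exact ⟨⟨φ s, hs0'⟩, @hKs x⟩
  -- characteristic ideals
  have H := charIdeal_quotSMulTop_eq_mul_of_twist u φ hφf hC hX hker N ht0 ht hg hg0
  obtain ⟨F, hF⟩ := (isPrincipal_charIdeal_of_ufm (R := IwasawaAlgebra p)
    (M := Submodule.torsionBy (IwasawaAlgebra₂ p) N f)).principal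
  have hF' : charIdeal (IwasawaAlgebra p) (Submodule.torsionBy (IwasawaAlgebra₂ p) N f) = Ideal.span {F} := hF
  -- the characteristic ideal of any module over a domain is non-zero (a finite product of powers of height-one primes, or `1`)
  have hne : ∀ (M : Type v) [AddCommGroup M] [Module (IwasawaAlgebra p) M], charIdeal (IwasawaAlgebra p) M ≠ ⊥ := by
    intro M _ _
    unfold charIdeal
    refine finprod_mem_induction (fun I : Ideal (IwasawaAlgebra p) ↦ I ≠ ⊥) ?_ (fun I J hI hJ ↦ ?_) ?_
    · rw [Ideal.one_eq_top]; exact top_ne_bot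
    · exact fun h ↦ (Ideal.mul_eq_bot.mp h).elim hI hJ
    · intro 𝔭 h𝔭
      exact pow_ne_zero _ (Ideal.ne_bot_of_height_eq_one h𝔭)
  have hF0 : F ≠ 0 := fun h0 ↦ hne _ (by rw [hF', h0, Ideal.span_singleton_eq_bot])
  have HQ : charIdeal (IwasawaAlgebra p) (QuotSMulTop f N) = Ideal.span {F * φ g} := by
    rw [H, hF', Ideal.span_singleton_mul_span_singleton]
  have hFg0 : F * φ g ≠ 0 := mul_ne_zero hF0 hg0
  refine ⟨hfinQ, htorQ, hfinK, htorK, ?_⟩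
  rw [← lam_generator_eq_lambdaInvariant (QuotSMulTop f N) htorQ hFg0 HQ,
    ← lam_generator_eq_lambdaInvariant (Submodule.torsionBy (IwasawaAlgebra₂ p) N f) htorK hF0 hF', lam_mul hF0 hg0]

include hφf hC hX hker in
/-- ★ **Road D's use of the λ-specialisation lemma.** If two finitely generated torsion `Λ₂`-modules `A`, `B` have the SAME characteristic ideal
`char_{Λ₂} A = char_{Λ₂} B = (g)` (Johnson-Leung–Kings Cor. 5.3 shape) with `φ g ≠ 0`, then along `f = (1+T₂) − u` (all `Λ`-structures = restriction
along `ι = PowerSeries.map C`): `λ(A/fA) + λ(B[f]) = λ(B/fB) + λ(A[f])` — the specialised series `lam(φ g)` cancels, so E2-K's λ-statement on the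
`θ`-line is pure bookkeeping on the descent sequences and the two torsion kernels. [cite: JohnsonLeungKings2011, §4.2, Lemma 4.4, Cor. 5.3]
[cite: BourbakiAC5to7, VII §4.5] -/
theorem lambdaInvariant_quotSMulTop_add_eq_of_charIdeal_eq (A B : Type v) [AddCommGroup A] [Module (IwasawaAlgebra₂ p) A]
    [Module.Finite (IwasawaAlgebra₂ p) A] [AddCommGroup B] [Module (IwasawaAlgebra₂ p) B] [Module.Finite (IwasawaAlgebra₂ p) B]
    {tA : IwasawaAlgebra₂ p} (htA0 : tA ≠ 0) (htA : ∀ a : A, tA • a = 0)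
    {tB : IwasawaAlgebra₂ p} (htB0 : tB ≠ 0) (htB : ∀ b : B, tB • b = 0)
    {g : IwasawaAlgebra₂ p} (hgA : charIdeal (IwasawaAlgebra₂ p) A = Ideal.span {g})
    (hAB : charIdeal (IwasawaAlgebra₂ p) A = charIdeal (IwasawaAlgebra₂ p) B) (hg0 : φ g ≠ 0) :
    letI : Algebra (IwasawaAlgebra p) (IwasawaAlgebra₂ p) :=
      (PowerSeries.map (PowerSeries.C : ℤ_[p] →+* IwasawaAlgebra p)).toAlgebra
    letI : Module (IwasawaAlgebra p) A := Module.compHom A (PowerSeries.map (PowerSeries.C : ℤ_[p] →+* IwasawaAlgebra p))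
    letI : Module (IwasawaAlgebra p) B := Module.compHom B (PowerSeries.map (PowerSeries.C : ℤ_[p] →+* IwasawaAlgebra p))
    haveI : IsScalarTower (IwasawaAlgebra p) (IwasawaAlgebra₂ p) A := IsScalarTower.of_algebraMap_smul fun _ _ ↦ rfl
    haveI : IsScalarTower (IwasawaAlgebra p) (IwasawaAlgebra₂ p) B := IsScalarTower.of_algebraMap_smul fun _ _ ↦ rfl
    lambdaInvariant p (QuotSMulTop (1 + (C (X : IwasawaAlgebra p) : IwasawaAlgebra₂ p) - C (C u)) A) +
        lambdaInvariant p
          (Submodule.torsionBy (IwasawaAlgebra₂ p) B (1 + (C (X : IwasawaAlgebra p) : IwasawaAlgebra₂ p) - C (C u))) =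
      lambdaInvariant p (QuotSMulTop (1 + (C (X : IwasawaAlgebra p) : IwasawaAlgebra₂ p) - C (C u)) B) +
        lambdaInvariant p
          (Submodule.torsionBy (IwasawaAlgebra₂ p) A (1 + (C (X : IwasawaAlgebra p) : IwasawaAlgebra₂ p) - C (C u))) := by
  have hA := (lambdaInvariant_quotSMulTop_eq_add_of_twist u φ hφf hC hX hker A htA0 htA hgA hg0).2.2.2.2
  have hB := (lambdaInvariant_quotSMulTop_eq_add_of_twist u φ hφf hC hX hker B htB0 htB (hAB ▸ hgA) hg0).2.2.2.2
  omega

end Twist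

end Summit.BirchSwinnertonDyer.BirchSwinnertonDyer.Theorems.SmallImageRttD2LamSpec

end
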